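import Literature.AlgebraicGeometry.ComplexMultiplication.CyclotomicFermatCMTypesUpToNinePrimeLevelSimple
import HarnessLib

/-!
# Koblitz–Rohrlich 1978, §2 "Case 5. `m ≥ 10`" and the PROPOSITION at every level prime to `6`; Theorems 1 (i)–(ii) and 2 (relatively prime
# case) UNCONDITIONALLY at every such level

N. Koblitz, D. Rohrlich, *Simple factors in the Jacobian of a Fermat curve*, Canad. J. Math. **30** (1978) 1183–1205, §2 (pp. 1190–1192).

THE SOURCE.  "PROPOSITION.  Suppose `2, 3 ∤ N`. Let `S(N)` be the set of odd characters of `(ℤ/Nℤ)^*`, and let `S₀(N) ⊂ S(N)` be the set of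
"bad" characters, i.e., `S₀(N) = {χ ∈ S(N) | B_{1,χ} = 0}`.  Then `#S₀(N) < (1/6)#S(N)`" (p. 1190).  The last case of its proof (p. 1192):
"Case 5. `m ≥ 10`.  We show that for all `pᵢ` we have `(pᵢ − 1)ordᵢ > 6m`, which will imply `s(N) = Σᵢ 1/((pᵢ − 1)ordᵢ) < 1/6`.
(1) `pᵢ = 5`. `ordᵢ > log₅(7·11·13·17·19·23·29·31·37·41^{m−10}) ≥ 16 + 5(m − 10)/2 > 3m/2` … (2) `pᵢ = 7`. … (3) `pᵢ = 11`.
`(pᵢ − 1)ordᵢ ≥ 10(m − 2) > 6m` by (1).  (4) `13 ≤ pᵢ ≤ 3m/2 + 1`. … there are at least `m/2` primes `> pᵢ` among `p₁, …, p_m`. Then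
`ordᵢ > log_{pᵢ} pᵢ^{m/2} = m/2` … (5) `3m/2 + 1 < pᵢ ≤ 6m + 1`.  It suffices to prove that `ordᵢ ≥ 4`. … (6) `pᵢ > 6m + 1`.  Then obviously
`(pᵢ − 1)ordᵢ > 6m`.  This completes the proof."

THIS FILE proves the per-prime bound of Case 5 in the uniform shape of the sibling criterion `twelve_mul_card_bad_lt_totient_of_forall_le`
(`CyclotomicFermatCMTypesBadCharacterCriterion`) and assembles, with the sibling `CyclotomicFermatCMTypesUpToNinePrimeLevelSimple` (`ω(N) ≤ 9`),
the Proposition at EVERY level `N > 1` prime to `6`, hence Theorems 1 (i)–(ii) and 2 in the relatively prime case there, unconditionally.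
DEVIATIONS (said once, here): in (4) K–R count primes ("no more than `m/2 − 1` primes `p` with `5 ≤ p ≤ 3m/2 − 1`"); we count residues
`±1 (mod 6)` instead (`q ↦ q/3` injects the primes `5 ≤ q < ℓ` into `[1, (ℓ − 2)/3]`, so `3s + 2 ≤ ℓ`), which suffices for the uniform bound;
in (5) we use `5^{m−1} ≤ ∏_{q ≠ ℓ} q < ℓ³ ≤ (6m + 1)³` instead of the product of the first `m` primes; in (1)–(2) the printed constants
`7·11·…·37 = 247357937827` and `11·…·37 = 35336848261` are used through a layer bound (`∏ T·41^{#Q − #T} ≤ ∏ Q`).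

* §1 `prod_mul_pow_le_prod` (layer bound), the primes `5 < q < 41`, `(6k + 7)³ ≤ 5ᵏ` (`k ≥ 9`) — private.
* §2 `criterion_le_sub_one_mul_of_nine_le_card` — `ℓ` prime `≥ 5`, `d ≥ 1`, `Q` a set of `≥ 9` primes `≥ 5` dividing `ℓᵈ − 1` ⟹
  `6(#Q + 1) + 1 ≤ (ℓ − 1)·d`.
* §3 `twelve_mul_card_bad_lt_totient_of_ten_le_card_primeFactors`, `exists_goodFinset_of_ten_le_card_primeFactors` (`ω(N) ≥ 10`);
  **`exists_goodFinset_of_five_le_primeFactors`, `twelve_mul_card_bad_lt_totient_of_five_le_primeFactors` — the Proposition at every `N > 1`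
  all of whose prime factors are `≥ 5`.**
* §4 the `…_of_five_le_primeFactors` family — Theorem 1 (i), (∗), Theorem 2 (stabiliser / CM type / variety), Theorem 1 (ii) at every such level.
* §5 `six_mul_card_bad_lt_card_odd_of_five_le_primeFactors` — the Proposition in the printed normalisation `6·#S₀(N) < #S(N)` (`#S(N) = φ(N)/2`).

No new definitions, no named facts.
-/

open NumberField

namespace Literature.AlgebraicGeometry.ComplexMultiplication

open Literature.NumberTheory.ComplexMultiplication
open Literature.NumberTheory.LFunctions

namespace CyclotomicFermatCMType

/-! ## §1 A layer bound for products of primes and the small primes `< 41` -/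

section Layer

/-- **Layer bound.** If the elements of `Q` below `B` all lie in `T`, the elements of `T` are `≤ B`, and `#T ≤ #Q`, then
`∏ T · B^{#Q − #T} ≤ ∏ Q` (the elements of `Q` outside `T` are `≥ B`, and trading an element of `T` for `B` does not decrease a product). [folklore] -/
private theorem prod_mul_pow_le_prod {Q T : Finset ℕ} {B : ℕ} (hT : ∀ q ∈ T, q ≤ B) (hQ : ∀ q ∈ Q, q < B → q ∈ T)
    (hcard : T.card ≤ Q.card) : (∏ q ∈ T, q) * B ^ (Q.card - T.card) ≤ ∏ q ∈ Q, q := by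
  classical
  set Q' := Q.filter (· < B) with hQ'
  set Q'' := Q.filter (fun q => ¬q < B) with hQ''
  have hsub : Q' ⊆ T := fun q hq => by
    rw [hQ', Finset.mem_filter] at hq
    exact hQ q hq.1 hq.2
  have h1 : B ^ Q''.card ≤ ∏ q ∈ Q'', q :=
    Finset.pow_card_le_prod Q'' (fun q => q) B fun q hq => by
      rw [hQ'', Finset.mem_filter] at hq
      exact not_lt.1 hq.2
  have h2 : ∏ q ∈ T, q ≤ (∏ q ∈ Q', q) * B ^ (T.card - Q'.card) := by
    rw [← Finset.prod_sdiff hsub, mul_comm, ← Finset.card_sdiff_of_subset hsub]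
    exact Nat.mul_le_mul_left _ (Finset.prod_le_pow_card (T \ Q') (fun q => q) B fun q hq => hT q (Finset.mem_sdiff.1 hq).1)
  have hcQ : Q'.card + Q''.card = Q.card := Finset.card_filter_add_card_filter_not (· < B)
  have hQ'T : Q'.card ≤ T.card := Finset.card_le_card hsub
  calc (∏ q ∈ T, q) * B ^ (Q.card - T.card) ≤ (∏ q ∈ Q', q) * B ^ (T.card - Q'.card) * B ^ (Q.card - T.card) :=
        Nat.mul_le_mul_right _ h2
    _ = (∏ q ∈ Q', q) * B ^ Q''.card := by
        rw [mul_assoc, ← pow_add]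
        congr 2
        omega
    _ ≤ (∏ q ∈ Q', q) * ∏ q ∈ Q'', q := Nat.mul_le_mul_left _ h1
    _ = ∏ q ∈ Q, q := Finset.prod_filter_mul_prod_filter_not Q (· < B) fun q => q

/-- The primes `q` with `5 < q < 41`. [folklore] -/
private theorem mem_of_prime_lt_41 {q : ℕ} (hq : q.Prime) (h5 : 5 < q) (h41 : q < 41) :
    q ∈ ({7, 11, 13, 17, 19, 23, 29, 31, 37} : Finset ℕ) := by
  interval_cases q <;> first | exact absurd hq (by decide) | simp

/-- `7·11·13·17·19·23·29·31·37 = 247357937827` (K–R's constant of Case 5 (1)). [cite: KoblitzRohrlich1978, §2 Case 5 (1) (p. 1192)] -/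
private theorem prod_primes_7_to_37 : (∏ q ∈ ({7, 11, 13, 17, 19, 23, 29, 31, 37} : Finset ℕ), q) = 247357937827 := by
  decide

/-- `11·13·17·19·23·29·31·37 = 35336848261`. [folklore] -/
private theorem prod_primes_11_to_37 : (∏ q ∈ ({11, 13, 17, 19, 23, 29, 31, 37} : Finset ℕ), q) = 35336848261 := by
  decide

/-- `(6k + 7)³ ≤ 5ᵏ` for `k ≥ 9` (K–R, Case 5 (5): "`(6m + 1)⁴` is less than the product of the first `m` primes starting with `5` as soon as `m ≥ 7`";
here the cruder `5ᵏ` and the cube suffice). [cite: KoblitzRohrlich1978, §2 Case 5 (5) (p. 1192)] -/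
private theorem cube_le_five_pow {k : ℕ} (hk : 9 ≤ k) : (6 * k + 7) ^ 3 ≤ 5 ^ k := by
  induction k, hk using Nat.le_induction with
  | base => norm_num
  | succ k hk ih =>
    have h1 : (6 * (k + 1) + 7) ^ 3 ≤ 5 * (6 * k + 7) ^ 3 := by
      have h := Nat.pow_le_pow_left (show 10 * (6 * (k + 1) + 7) ≤ 17 * (6 * k + 7) by omega) 3
      rw [mul_pow, mul_pow] at h
      have h' : 10 ^ 3 * (6 * (k + 1) + 7) ^ 3 ≤ 10 ^ 3 * (5 * (6 * k + 7) ^ 3) :=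
        h.trans (by rw [← mul_assoc]; exact Nat.mul_le_mul_right _ (by norm_num))
      exact Nat.le_of_mul_le_mul_left h' (by norm_num)
    calc (6 * (k + 1) + 7) ^ 3 ≤ 5 * (6 * k + 7) ^ 3 := h1
      _ ≤ 5 * 5 ^ k := Nat.mul_le_mul_left _ ih
      _ = 5 ^ (k + 1) := by ring

end Layer

/-! ## §2 The per-prime bound `(ℓ − 1)·d ≥ 6m + 1` when `m − 1 ≥ 9` distinct primes `≥ 5` divide `ℓᵈ − 1` ("Case 5. `m ≥ 10`") -/

section CaseFive

/-- **`(ℓ − 1)·d ≥ 6m + 1` for `m ≥ 10`** ("Case 5. `m ≥ 10`.  We show that for all `pᵢ` we have `(pᵢ − 1)ordᵢ > 6m`", p. 1192): if `ℓ` is a prime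
`≥ 5`, `d ≥ 1`, and `Q` is a set of at least nine primes `≥ 5` each dividing `ℓᵈ − 1`, then `6(#Q + 1) + 1 ≤ (ℓ − 1)·d`.  Following K–R:
`ℓ = 5`: `5ᵈ > ∏ Q ≥ 7·11·13·17·19·23·29·31·37·41^{#Q−9} ≥ 5^{2#Q−2}` ("(1) `pᵢ = 5`. `ordᵢ > log₅(7·11·…·37·41^{m−10}) ≥ 16 + 5(m − 10)/2 > 3m/2`");
`ℓ = 7`: `7ᵈ > 11·13·…·37·41^{t−8} ≥ 7^{t+4}` with `t ≥ #Q − 1` primes of `Q` above `7` ("(2) `pᵢ = 7`"); `ℓ = 11`: `d > t ≥ #Q − 2` ("(3) `pᵢ = 11`.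
`(pᵢ − 1)ordᵢ ≥ 10(m − 2) > 6m` by (1)"); `ℓ ≥ 13`: with `t` = the number of primes of `Q` above `ℓ` and `s = #Q − t`, `d ≥ t + 1` ("Note that
`ordᵢ > log_{pᵢ} Nᵢ ≥ m − i`") and `3s + 2 ≤ ℓ` (the primes below `ℓ` are `≡ ±1 (mod 6)`; K–R's "(4)" uses the sharper "no more than `m/2 − 1` primes
`p` with `5 ≤ p ≤ 3m/2 − 1`"), then "(4) `13 ≤ pᵢ ≤ 3m/2 + 1`", "(5) `3m/2 + 1 < pᵢ ≤ 6m + 1`. It suffices to prove that `ordᵢ ≥ 4` …" (here via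
`5^{#Q} ≤ ∏ Q < ℓ³ ≤ (6m + 1)³`), "(6) `pᵢ > 6m + 1`. Then obviously `(pᵢ − 1)ordᵢ > 6m`".
[cite: KoblitzRohrlich1978, §2 Proposition, Case 5 (p. 1192)] -/
theorem criterion_le_sub_one_mul_of_nine_le_card {ℓ d : ℕ} (hℓ : ℓ.Prime) (hℓ5 : 5 ≤ ℓ) (hd : 0 < d) {Q : Finset ℕ}
    (hQ : ∀ q ∈ Q, q.Prime ∧ 5 ≤ q ∧ q ∣ ℓ ^ d - 1) (h9 : 9 ≤ Q.card) : 6 * (Q.card + 1) + 1 ≤ (ℓ - 1) * d := by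
  classical
  -- `∏ Q ∣ ℓᵈ − 1`, so `∏ Q < ℓᵈ`; no element of `Q` is `ℓ`
  have h1d : 1 ≤ ℓ ^ d := Nat.one_le_pow _ _ hℓ.pos
  have hpos : 0 < ℓ ^ d - 1 := by
    have : ℓ ^ 1 ≤ ℓ ^ d := Nat.pow_le_pow_right hℓ.pos hd
    rw [pow_one] at this
    omega
  have hprod : ∏ q ∈ Q, q ∣ ℓ ^ d - 1 :=
    Finset.prod_primes_dvd _ (fun q hq => Nat.prime_iff.1 (hQ q hq).1) fun q hq => (hQ q hq).2.2
  have hlt : ∏ q ∈ Q, q < ℓ ^ d := lt_of_le_of_lt (Nat.le_of_dvd hpos hprod) (by omega)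
  have hne : ∀ q ∈ Q, q ≠ ℓ := by
    intro q hq hql
    have hdvd : ℓ ∣ ℓ ^ d - 1 := hql ▸ (hQ q hq).2.2
    have h1 : ℓ ∣ ℓ ^ d - 1 + 1 := by
      rw [Nat.sub_add_cancel h1d]
      exact dvd_pow_self ℓ hd.ne'
    exact hℓ.one_lt.ne' (Nat.dvd_one.1 ((Nat.dvd_add_right hdvd).1 h1))
  -- the primes of `Q` above `ℓ`: `t` of them, and `d ≥ t + 1`
  set t := (Q.filter (ℓ < ·)).card with ht
  have hsubU : Q.filter (ℓ < ·) ⊆ Q := Finset.filter_subset _ _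
  have hprodU : ∏ q ∈ Q.filter (ℓ < ·), q ≤ ∏ q ∈ Q, q :=
    Finset.prod_le_prod_of_subset_of_one_le' hsubU fun q hq _ => (hQ q hq).1.one_lt.le
  have htd : t < d := by
    have h1 : (ℓ + 1) ^ t ≤ ∏ q ∈ Q.filter (ℓ < ·), q :=
      Finset.pow_card_le_prod _ (fun q => q) _ fun q hq => (Finset.mem_filter.1 hq).2
    have h3 : ℓ ^ t < ℓ ^ d := lt_of_le_of_lt ((Nat.pow_le_pow_left (Nat.le_succ ℓ) t).trans (h1.trans hprodU)) hlt
    exact (Nat.pow_lt_pow_iff_right hℓ.one_lt).1 h3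
  -- the primes of `Q` below `ℓ`: `s` of them
  set s := (Q.filter fun q => ¬ℓ < q).card with hs
  have hst : t + s = Q.card := Finset.card_filter_add_card_filter_not (ℓ < ·)
  have hmemL : ∀ q ∈ Q.filter (fun q => ¬ℓ < q), q.Prime ∧ 5 ≤ q ∧ q < ℓ := fun q hq => by
    obtain ⟨hqQ, hqℓ⟩ := Finset.mem_filter.1 hq
    exact ⟨(hQ q hqQ).1, (hQ q hqQ).2.1, lt_of_le_of_ne (not_lt.1 hqℓ) (hne q hqQ)⟩
  by_cases h13 : 13 ≤ ℓ
  · -- `3s + 2 ≤ ℓ`: `q ↦ q / 3` injects the primes `5 ≤ q < ℓ` of `Q` into `[1, (ℓ − 2)/3]`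
    have hℓ2 : ¬2 ∣ ℓ := fun h => by rcases hℓ.eq_one_or_self_of_dvd 2 h with h | h <;> omega
    have h3s : 3 * s + 2 ≤ ℓ := by
      have hmaps : Set.MapsTo (fun q => q / 3) ↑(Q.filter fun q => ¬ℓ < q) ↑(Finset.Icc 1 ((ℓ - 2) / 3)) := by
        intro q hq
        obtain ⟨hqp, hq5, hqℓ⟩ := hmemL q hq
        have hq2 : ¬2 ∣ q := fun h => by rcases hqp.eq_one_or_self_of_dvd 2 h with h | h <;> omega
        dsimp only
        rw [Finset.coe_Icc, Set.mem_Icc]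
        constructor <;> omega
      have hinj : Set.InjOn (fun q => q / 3) ↑(Q.filter fun q => ¬ℓ < q) := by
        intro q hq q' hq' h
        obtain ⟨hqp, hq5, -⟩ := hmemL q hq
        obtain ⟨hqp', hq5', -⟩ := hmemL q' hq'
        have hq2 : ¬2 ∣ q := fun h => by rcases hqp.eq_one_or_self_of_dvd 2 h with h | h <;> omega
        have hq3 : ¬3 ∣ q := fun h => by rcases hqp.eq_one_or_self_of_dvd 3 h with h | h <;> omega
        have hq2' : ¬2 ∣ q' := fun h => by rcases hqp'.eq_one_or_self_of_dvd 2 h with h | h <;> omega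
        have hq3' : ¬3 ∣ q' := fun h => by rcases hqp'.eq_one_or_self_of_dvd 3 h with h | h <;> omega
        dsimp only at h
        omega
      have := Finset.card_le_card_of_injOn (fun q => q / 3) hmaps hinj
      rw [Nat.card_Icc] at this
      omega
    by_cases hA : 2 * ℓ ≤ 3 * Q.card + 5
    · -- "(4)": `s ≤ t`, so `(ℓ − 1)(t + 1) ≥ 12(t + 1) ≥ 6(s + t) + 7`
      have h12 : 12 * (t + 1) ≤ (ℓ - 1) * d := Nat.mul_le_mul (by omega) (by omega)
      omega
    · by_cases hB : ℓ ≤ 6 * Q.card + 7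
      · -- "(5)": `d ≥ 4`, for `d ≤ 3` would give `5^{#Q} ≤ ∏ Q < ℓ³ ≤ (6#Q + 7)³`
        have hd4 : 4 ≤ d := by
          by_contra hlt
          have h5 : 5 ^ Q.card ≤ ∏ q ∈ Q, q := Finset.pow_card_le_prod Q (fun q => q) 5 fun q hq => (hQ q hq).2.1
          have h6 : ℓ ^ d ≤ (6 * Q.card + 7) ^ 3 :=
            (Nat.pow_le_pow_right hℓ.pos (by omega)).trans (Nat.pow_le_pow_left hB 3)
          have := cube_le_five_pow h9
          omega
        have h4 : (ℓ - 1) * 4 ≤ (ℓ - 1) * d := Nat.mul_le_mul_left _ hd4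
        omega
      · -- "(6)": `ℓ > 6#Q + 7`
        have h1 : (ℓ - 1) * 1 ≤ (ℓ - 1) * d := Nat.mul_le_mul_left _ hd
        omega
  · -- `ℓ ∈ {5, 7, 11}`
    have hℓ' : ℓ = 5 ∨ ℓ = 7 ∨ ℓ = 11 := by
      interval_cases ℓ
      · exact Or.inl rfl
      · exact absurd hℓ (by decide)
      · exact Or.inr (Or.inl rfl)
      · exact absurd hℓ (by decide)
      · exact absurd hℓ (by decide)
      · exact absurd hℓ (by decide)
      · exact Or.inr (Or.inr rfl)
      · exact absurd hℓ (by decide)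
    rcases hℓ' with rfl | rfl | rfl
    · -- `ℓ = 5`: every element of `Q` is a prime `> 5`; layer bound with the primes below `41`
      have hlayer := prod_mul_pow_le_prod (Q := Q) (T := {7, 11, 13, 17, 19, 23, 29, 31, 37}) (B := 41)
        (fun q hq => by simp only [Finset.mem_insert, Finset.mem_singleton] at hq; omega)
        (fun q hq hq41 => mem_of_prime_lt_41 (hQ q hq).1 (lt_of_le_of_ne (hQ q hq).2.1 (hne q hq).symm) hq41)
        (by rw [show ({7, 11, 13, 17, 19, 23, 29, 31, 37} : Finset ℕ).card = 9 by simp]; omega)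
      rw [prod_primes_7_to_37, show ({7, 11, 13, 17, 19, 23, 29, 31, 37} : Finset ℕ).card = 9 by simp] at hlayer
      -- `5^{2#Q − 2} = 5¹⁶·25^{#Q − 9} ≤ 247357937827·41^{#Q − 9} ≤ ∏ Q < 5ᵈ`
      have hpow : 5 ^ (2 * Q.card - 2) ≤ 247357937827 * 41 ^ (Q.card - 9) := by
        rw [show 2 * Q.card - 2 = 16 + 2 * (Q.card - 9) by omega, pow_add, pow_mul]
        exact Nat.mul_le_mul (by norm_num) (Nat.pow_le_pow_left (by norm_num) _)
      have := (Nat.pow_lt_pow_iff_right (by norm_num : 1 < 5)).1 (lt_of_le_of_lt (hpow.trans hlayer) hlt)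
      omega
    · -- `ℓ = 7`: at most one element (`5`) lies below `7`, so `t ≥ #Q − 1 ≥ 8`; layer bound above `7`
      have hs1 : s ≤ 1 := by
        have : (Q.filter fun q => ¬7 < q) ⊆ {5} := fun q hq => by
          obtain ⟨hqp, hq5, hq7⟩ := hmemL q hq
          rw [Finset.mem_singleton]
          interval_cases q
          · rfl
          · exact absurd hqp (by decide)
        exact (Finset.card_le_card this).trans (by simp)
      have hlayer := prod_mul_pow_le_prod (Q := Q.filter (7 < ·)) (T := {11, 13, 17, 19, 23, 29, 31, 37}) (B := 41)
        (fun q hq => by simp only [Finset.mem_insert, Finset.mem_singleton] at hq; omega)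
        (fun q hq hq41 => by
          obtain ⟨hqQ, hq7⟩ := Finset.mem_filter.1 hq
          have h := mem_of_prime_lt_41 (hQ q hqQ).1 (by omega) hq41
          simp only [Finset.mem_insert, Finset.mem_singleton] at h ⊢
          omega)
        (by rw [show ({11, 13, 17, 19, 23, 29, 31, 37} : Finset ℕ).card = 8 by simp]; omega)
      rw [prod_primes_11_to_37, show ({11, 13, 17, 19, 23, 29, 31, 37} : Finset ℕ).card = 8 by simp] at hlayer
      have hpow : 7 ^ (t + 4) ≤ 35336848261 * 41 ^ (t - 8) := by
        rw [show t + 4 = 12 + (t - 8) by omega, pow_add]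
        exact Nat.mul_le_mul (by norm_num) (Nat.pow_le_pow_left (by norm_num) _)
      have := (Nat.pow_lt_pow_iff_right (by norm_num : 1 < 7)).1 (lt_of_le_of_lt (hpow.trans (hlayer.trans hprodU)) hlt)
      omega
    · -- `ℓ = 11`: at most two elements (`5, 7`) lie below `11`, so `d ≥ t + 1 ≥ #Q − 1`
      have hs2 : s ≤ 2 := by
        have : (Q.filter fun q => ¬11 < q) ⊆ {5, 7} := fun q hq => by
          obtain ⟨hqp, hq5, hq11⟩ := hmemL q hq
          rw [Finset.mem_insert, Finset.mem_singleton]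
          interval_cases q
          · exact Or.inl rfl
          · exact absurd hqp (by decide)
          · exact Or.inr rfl
          · exact absurd hqp (by decide)
          · exact absurd hqp (by decide)
          · exact absurd hqp (by decide)
        exact (Finset.card_le_card this).trans (by simp)
      have h10 : (11 - 1) * (t + 1) ≤ (11 - 1) * d := Nat.mul_le_mul_left _ htd
      omega

end CaseFive


/-! ## §3 The Proposition at levels with at least ten prime factors `≥ 5`, and at EVERY level `N > 1` prime to `6` -/

section AllLevels

variable {N : ℕ}

/-- The criterion's hypothesis at levels with `ω(N) ≥ 10` prime factors `≥ 5`. [cite: KoblitzRohrlich1978, §2 Proposition, Case 5 (p. 1192)] -/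
private theorem criterion_ten_le (h10 : 10 ≤ N.primeFactors.card) (h5 : ∀ ℓ ∈ N.primeFactors, 5 ≤ ℓ) :
    ∀ ℓ ∈ N.primeFactors, ∀ d : ℕ, 0 < d → ordCompl[ℓ] N ∣ ℓ ^ d - 1 → 6 * N.primeFactors.card + 1 ≤ (ℓ - 1) * d := by
  classical
  intro ℓ hℓ d hd hdvd
  have hℓp : ℓ.Prime := Nat.prime_of_mem_primeFactors hℓ
  have mem : ∀ q ∈ N.primeFactors.erase ℓ, q.Prime ∧ 5 ≤ q ∧ q ∣ ℓ ^ d - 1 := by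
    intro q hq
    obtain ⟨hqℓ, hqN⟩ := Finset.mem_erase.1 hq
    have hqp : q.Prime := Nat.prime_of_mem_primeFactors hqN
    refine ⟨hqp, h5 q hqN, dvd_trans (Nat.dvd_ordCompl_of_dvd_not_dvd (Nat.dvd_of_mem_primeFactors hqN) ?_) hdvd⟩
    intro h
    exact hqℓ ((Nat.prime_dvd_prime_iff_eq hℓp hqp).1 h).symm
  have hc : (N.primeFactors.erase ℓ).card + 1 = N.primeFactors.card := Finset.card_erase_add_one hℓ
  rw [← hc]
  exact criterion_le_sub_one_mul_of_nine_le_card hℓp (h5 ℓ hℓ) hd mem (by omega)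

/-- **THE PROPOSITION AT LEVELS WITH AT LEAST TEN PRIME FACTORS** ("Case 5. `m ≥ 10`"): if `N` has at least ten prime factors, all `≥ 5`, then
`12·#{χ mod N odd : B_{1,χ} = 0} < φ(N)`. [cite: KoblitzRohrlich1978, §2 Proposition (p. 1190) and Case 5 (p. 1192)] -/
theorem twelve_mul_card_bad_lt_totient_of_ten_le_card_primeFactors [NeZero N] (h10 : 10 ≤ N.primeFactors.card)
    (h5 : ∀ ℓ ∈ N.primeFactors, 5 ≤ ℓ) :
    12 * Nat.card {χ : DirichletCharacter ℂ N // χ.Odd ∧ bernoulliOneChar χ = 0} < N.totient :=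
  twelve_mul_card_bad_lt_totient_of_forall_le (criterion_ten_le h10 h5)

/-- The sibling's hypothesis at levels with at least ten prime factors `≥ 5`. [cite: KoblitzRohrlich1978, §2 Proposition (p. 1190) and Case 5 (p. 1192)] -/
theorem exists_goodFinset_of_ten_le_card_primeFactors [NeZero N] (h10 : 10 ≤ N.primeFactors.card)
    (h5 : ∀ ℓ ∈ N.primeFactors, 5 ≤ ℓ) :
    ∃ S₀ : Finset (DirichletCharacter ℂ N),
      (∀ ψ : DirichletCharacter ℂ N, ψ.Odd → bernoulliOneChar ψ = 0 → ψ ∈ S₀) ∧ 12 * S₀.card < N.totient :=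
  exists_goodFinset_of_forall_le (criterion_ten_le h10 h5)

/-- **KOBLITZ–ROHRLICH'S PROPOSITION, EVERY LEVEL** ("PROPOSITION.  Suppose `2, 3 ∤ N`. … Then `#S₀(N) < (1/6)#S(N)`", p. 1190), in the shape
consumed by the tree: if `N > 1` and every prime factor of `N` is `≥ 5`, there is a finset `S₀` containing every odd character mod `N` with
`B_{1,χ} = 0` and `12·#S₀ < φ(N)` (`ω(N) ≤ 9`: the sibling `CyclotomicFermatCMTypesUpToNinePrimeLevelSimple`; `ω(N) ≥ 10`: §2).
[cite: KoblitzRohrlich1978, §2 Proposition (pp. 1190–1192)] -/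
theorem exists_goodFinset_of_five_le_primeFactors [NeZero N] (hN1 : 1 < N) (h5 : ∀ ℓ ∈ N.primeFactors, 5 ≤ ℓ) :
    ∃ S₀ : Finset (DirichletCharacter ℂ N),
      (∀ ψ : DirichletCharacter ℂ N, ψ.Odd → bernoulliOneChar ψ = 0 → ψ ∈ S₀) ∧ 12 * S₀.card < N.totient := by
  rcases Nat.lt_or_ge N.primeFactors.card 10 with h | h
  · exact exists_goodFinset_of_card_primeFactors_le_nine hN1 (by omega) h5
  · exact exists_goodFinset_of_ten_le_card_primeFactors h h5

/-- **KOBLITZ–ROHRLICH'S PROPOSITION, EVERY LEVEL, as the count `12·#S₀(N) < φ(N)`** (`#S(N) = φ(N)/2`): for `N > 1` with all prime factors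
`≥ 5`, `12·#{χ mod N odd : B_{1,χ} = 0} < φ(N)`. [cite: KoblitzRohrlich1978, §2 Proposition (pp. 1190–1192)] -/
theorem twelve_mul_card_bad_lt_totient_of_five_le_primeFactors [NeZero N] (hN1 : 1 < N) (h5 : ∀ ℓ ∈ N.primeFactors, 5 ≤ ℓ) :
    12 * Nat.card {χ : DirichletCharacter ℂ N // χ.Odd ∧ bernoulliOneChar χ = 0} < N.totient := by
  rcases Nat.lt_or_ge N.primeFactors.card 10 with h | h
  · exact twelve_mul_card_bad_lt_totient_of_card_primeFactors_le_nine hN1 (by omega) h5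
  · exact twelve_mul_card_bad_lt_totient_of_ten_le_card_primeFactors h h5

end AllLevels

/-! ## §4 Theorems 1 (i)–(ii) and 2, relatively prime case, UNCONDITIONALLY at every level `N > 1` prime to `6` -/

section EveryLevel

open CategoryTheory
open Literature.AlgebraicGeometry.Motives (AbelianVariety)
open Literature.AlgebraicGeometry.HodgeTheory
open Literature.AlgebraicGeometry.Pohlmann1968 Literature.AlgebraicGeometry.Pohlmann1968.Cyclotomic
open CyclotomicCMTypeResidueSets (IsCMResidueSet)

variable {N : ℕ} [NeZero N]

/-- A level `> 1` whose prime factors are all `≥ 5` is odd and carries a good finset. [folklore] -/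
private theorem level_hyps_all (hN1 : 1 < N) (h5 : ∀ ℓ ∈ N.primeFactors, 5 ≤ ℓ) :
    1 < N ∧ Odd N ∧ ∃ S₀ : Finset (DirichletCharacter ℂ N),
      (∀ ψ : DirichletCharacter ℂ N, ψ.Odd → bernoulliOneChar ψ = 0 → ψ ∈ S₀) ∧ 12 * S₀.card < N.totient := by
  have hodd : Odd N := by
    rw [← Nat.not_even_iff_odd]
    intro he
    have h2 : 2 ∈ N.primeFactors := Nat.mem_primeFactors.2 ⟨Nat.prime_two, even_iff_two_dvd.1 he, NeZero.ne N⟩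
    exact absurd (h5 2 h2) (by norm_num)
  exact ⟨hN1, hodd, exists_goodFinset_of_five_le_primeFactors hN1 h5⟩

/-- **THEOREM 1 (i), relatively prime case, UNCONDITIONALLY at every level `N > 1` prime to `6`** ("THEOREM 1.  Suppose `N` is prime to `6`.
Then: (i) `H_{r,s,t} = H_{r′,s′,t′}` if and only if `{r, s, t} ∼ {r′, s′, t′}`", here for unit triples and with the unit `h` explicit:
`H_{r₂,s₂,t₂} = h⁻¹H_{r₁,s₁,t₁}` iff `{r₂,s₂,t₂} = {hr₁,hs₁,ht₁}`). [cite: KoblitzRohrlich1978, Theorem 1 (i) (p. 1185) and §2 Proposition (pp. 1190–1192)] -/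
theorem forall_mem_fermatCMType_iff_iff_multiset_eq_of_five_le_primeFactors (hN1 : 1 < N) (h5 : ∀ ℓ ∈ N.primeFactors, 5 ≤ ℓ)
    {r₁ s₁ t₁ r₂ s₂ t₂ h : ZMod N}
    (hr₁ : IsUnit r₁) (hs₁ : IsUnit s₁) (ht₁ : IsUnit t₁) (h₁ : r₁ + s₁ + t₁ = 0)
    (hr₂ : IsUnit r₂) (hs₂ : IsUnit s₂) (ht₂ : IsUnit t₂) (h₂ : r₂ + s₂ + t₂ = 0) (hh : IsUnit h) :
    (∀ x, x ∈ fermatCMType N r₂ s₂ t₂ ↔ h * x ∈ fermatCMType N r₁ s₁ t₁) ↔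
      ({r₂, s₂, t₂} : Multiset (ZMod N)) = {h * r₁, h * s₁, h * t₁} := by
  obtain ⟨-, hN2, S₀, hS₀, hcard⟩ := level_hyps_all hN1 h5
  exact forall_mem_fermatCMType_iff_iff_multiset_eq_of_card hN1 hN2 S₀ hS₀ hcard hr₁ hs₁ ht₁ h₁ hr₂ hs₂ ht₂ h₂ hh

/-- **(∗) at every level `N > 1` prime to `6`**: `H_{r₂,s₂,t₂} = H_{r₁,s₁,t₁}` iff `{r₂,s₂,t₂} = {r₁,s₁,t₁}`. [cite: KoblitzRohrlich1978, §2 (∗) (p. 1187) and Proposition (pp. 1190–1192)] -/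
theorem fermatCMType_eq_iff_multiset_eq_of_five_le_primeFactors (hN1 : 1 < N) (h5 : ∀ ℓ ∈ N.primeFactors, 5 ≤ ℓ)
    {r₁ s₁ t₁ r₂ s₂ t₂ : ZMod N}
    (hr₁ : IsUnit r₁) (hs₁ : IsUnit s₁) (ht₁ : IsUnit t₁) (h₁ : r₁ + s₁ + t₁ = 0)
    (hr₂ : IsUnit r₂) (hs₂ : IsUnit s₂) (ht₂ : IsUnit t₂) (h₂ : r₂ + s₂ + t₂ = 0) :
    fermatCMType N r₂ s₂ t₂ = fermatCMType N r₁ s₁ t₁ ↔ ({r₂, s₂, t₂} : Multiset (ZMod N)) = {r₁, s₁, t₁} := by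
  obtain ⟨-, hN2, S₀, hS₀, hcard⟩ := level_hyps_all hN1 h5
  exact fermatCMType_eq_iff_multiset_eq_of_card hN1 hN2 S₀ hS₀ hcard hr₁ hs₁ ht₁ h₁ hr₂ hs₂ ht₂ h₂

/-- **THEOREM 2's stabiliser at every level `N > 1` prime to `6`.** [cite: KoblitzRohrlich1978, Theorem 2 (pp. 1185–1186) and Proposition (pp. 1190–1192)] -/
theorem forall_mem_fermatCMType_one_iff_mul_mem_iff_of_five_le_primeFactors (hN1 : 1 < N) (h5 : ∀ ℓ ∈ N.primeFactors, 5 ≤ ℓ)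
    {a₀ w : ZMod N} (ha₀ : IsUnit a₀) (ha₁ : IsUnit (1 + a₀)) (hw : IsUnit w) :
    (∀ x, x ∈ fermatCMType N 1 a₀ (-1 - a₀) ↔ w * x ∈ fermatCMType N 1 a₀ (-1 - a₀)) ↔
      w = 1 ∨ (1 + a₀ + a₀ ^ 2 = 0 ∧ (w = a₀ ∨ w = a₀ ^ 2)) := by
  obtain ⟨-, hN2, S₀, hS₀, hcard⟩ := level_hyps_all hN1 h5
  exact forall_mem_fermatCMType_one_iff_mul_mem_iff_of_card hN1 hN2 S₀ hS₀ hcard ha₀ ha₁ hw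

variable {L : Type} [Field L] [NumberField L] [IsCyclotomicExtension {N} ℚ L]
  {A A' : AbelianVariety ℂ} {ι : 𝓞 L →+* End A} {θ : L →+* Module.End ℂ (complexBetti A.X 1)}
  {ι' : 𝓞 L →+* End A'} {θ' : L →+* Module.End ℂ (complexBetti A'.X 1)}

/-- **THEOREM 2 on CM types at every level `N > 1` prime to `6`**: `Φ_{(1,a₀,−1−a₀)}` is primitive iff NOT (`1 + a₀ + a₀² = 0` and `a₀ ≠ 1`)
("THEOREM 2.  Suppose `N` is prime to `6`. The only lattices `L_{r,s,t}` which are not simple are those for which `{r, s, t}` is equivalent to a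
triple of the form `{N/M, (wN/M), (w²N/M)}` … such that `1 + w + w² = 0`, or … `w² = 1, w ≠ ±1`" — in the relatively prime case `M = N` and the
second family is empty). [cite: KoblitzRohrlich1978, Theorem 2 (pp. 1185–1186) and Proposition (pp. 1190–1192)] [cite: Shimura1998, §8.2 Prop. 26] -/
theorem isPrimitive_fermat_one_iff_of_five_le_primeFactors (hN1 : 1 < N) (h5 : ∀ ℓ ∈ N.primeFactors, 5 ≤ ℓ)
    {a₀ : ZMod N} (ha₀ : IsUnit a₀) (ha₁ : IsUnit (1 + a₀))
    {hS : ∀ x : ZMod N, x.val.Coprime N → (x ∈ fermatCMType N 1 a₀ (-1 - a₀) ↔ -x ∉ fermatCMType N 1 a₀ (-1 - a₀))}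
    (φ₀ : L →+* ℂ) :
    IsPrimitive (ℂ ≃+* ℂ) (cmTypeOfResidues (L := L) (fermatCMType N 1 a₀ (-1 - a₀)) hS).1 φ₀ ↔
      ¬(1 + a₀ + a₀ ^ 2 = 0 ∧ a₀ ≠ 1) := by
  obtain ⟨-, hN2, S₀, hS₀, hcard⟩ := level_hyps_all hN1 h5
  exact isPrimitive_fermat_one_iff_of_card hN1 hN2 S₀ hS₀ hcard ha₀ ha₁ φ₀

/-- **THEOREM 2 on abelian varieties at every level `N > 1` prime to `6`**: simple iff NOT (`1 + a₀ + a₀² = 0` and `a₀ ≠ 1`).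
[cite: KoblitzRohrlich1978, Theorem 2 (pp. 1185–1186) and Proposition (pp. 1190–1192)] [cite: Shimura1998, §8.2 Prop. 26] -/
theorem isSimple_of_fermat_one_iff_of_five_le_primeFactors (hN1 : 1 < N) (h5 : ∀ ℓ ∈ N.primeFactors, 5 ≤ ℓ)
    {a₀ : ZMod N} (ha₀ : IsUnit a₀) (ha₁ : IsUnit (1 + a₀))
    {hS : ∀ x : ZMod N, x.val.Coprime N → (x ∈ fermatCMType N 1 a₀ (-1 - a₀) ↔ -x ∉ fermatCMType N 1 a₀ (-1 - a₀))}
    (hA : IsCMTypeRealisation (cmTypeOfResidues (L := L) (fermatCMType N 1 a₀ (-1 - a₀)) hS) A ι θ) :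
    A.IsSimple ↔ ¬(1 + a₀ + a₀ ^ 2 = 0 ∧ a₀ ≠ 1) := by
  obtain ⟨-, hN2, S₀, hS₀, hcard⟩ := level_hyps_all hN1 h5
  exact isSimple_of_fermat_one_iff_of_card hN1 hN2 S₀ hS₀ hcard ha₀ ha₁ hA

/-- **THEOREM 1 (ii), relatively prime case, at every level `N > 1` prime to `6`** ("(ii) The only isogenies between the lattices `L_{r,s,t}` are
the obvious equalities"): isogeny iff `{r₂,s₂,t₂} = u·{r₁,s₁,t₁}` for a unit `u`.
[cite: KoblitzRohrlich1978, Theorem 1 (ii) (p. 1185) and Proposition (pp. 1190–1192)] [cite: Shimura1998, §8.4 Example (1) and §6.1 Corollary] -/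
theorem isIsogenous_fermatCMType_iff_exists_multiset_eq_of_five_le_primeFactors [IsCMField L] (hN1 : 1 < N)
    (h5 : ∀ ℓ ∈ N.primeFactors, 5 ≤ ℓ) {r₁ s₁ t₁ r₂ s₂ t₂ : ZMod N}
    (hr₁ : IsUnit r₁) (hs₁ : IsUnit s₁) (ht₁ : IsUnit t₁) (h₁ : r₁ + s₁ + t₁ = 0)
    (hr₂ : IsUnit r₂) (hs₂ : IsUnit s₂) (ht₂ : IsUnit t₂) (h₂ : r₂ + s₂ + t₂ = 0)
    (hS : IsCMResidueSet N (fermatCMType N r₁ s₁ t₁)) (hS' : IsCMResidueSet N (fermatCMType N r₂ s₂ t₂))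
    (hA : IsCMTypeRealisation (cmTypeOfResidues (L := L) (fermatCMType N r₁ s₁ t₁) hS.cm) A ι θ)
    (hA' : IsCMTypeRealisation (cmTypeOfResidues (L := L) (fermatCMType N r₂ s₂ t₂) hS'.cm) A' ι' θ') :
    AbelianVariety.IsIsogenous A A' ↔
      ∃ u : ZMod N, IsUnit u ∧ ({r₂, s₂, t₂} : Multiset (ZMod N)) = {u * r₁, u * s₁, u * t₁} := by
  obtain ⟨-, hN2, S₀, hS₀, hcard⟩ := level_hyps_all hN1 h5
  exact isIsogenous_fermatCMType_iff_exists_multiset_eq_of_card hN1 hN2 S₀ hS₀ hcard hr₁ hs₁ ht₁ h₁ hr₂ hs₂ ht₂ h₂ hS hS'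
    hA hA'

end EveryLevel

/-! ## §5 The Proposition in the printed normalisation `6·#S₀(N) < #S(N)` -/

section Printed

variable {N : ℕ} [NeZero N]

/-- `#S(N) = φ(N)/2`: twice the number of odd characters mod `N` is `φ(N)` when `N > 2` (the sibling's count at the unit `u = 1`). [folklore] -/
private theorem two_mul_card_odd_eq_totient (hN2 : 2 < N) :
    2 * Nat.card {χ : DirichletCharacter ℂ N // χ.Odd} = N.totient := by
  haveI : Fact (2 < N) := ⟨hN2⟩
  have hu : ∀ j : ℕ, (1 : (ZMod N)ˣ) ^ j ≠ -1 := fun j h => by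
    rw [one_pow] at h
    have h' := congrArg Units.val h
    rw [Units.val_neg, Units.val_one] at h'
    exact ZMod.neg_one_ne_one (n := N) h'.symm
  have h := two_mul_orderOf_mul_card_odd_apply_eq_one (1 : (ZMod N)ˣ) hu
  rw [orderOf_one, mul_one] at h
  have e : Nat.card {ψ : DirichletCharacter ℂ N // ψ.Odd ∧ ψ ((1 : (ZMod N)ˣ) : ZMod N) = 1} =
      Nat.card {χ : DirichletCharacter ℂ N // χ.Odd} :=
    Nat.card_congr (Equiv.subtypeEquivRight fun ψ => by rw [Units.val_one, map_one]; exact and_iff_left rfl)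
  rw [← e]
  exact h

/-- **KOBLITZ–ROHRLICH'S PROPOSITION AS PRINTED** ("PROPOSITION.  Suppose `2, 3 ∤ N`. Let `S(N)` be the set of odd characters of `(ℤ/Nℤ)^*`,
and let `S₀(N) ⊂ S(N)` be the set of "bad" characters, i.e., `S₀(N) = {χ ∈ S(N) | B_{1,χ} = 0}`.  Then `#S₀(N) < (1/6)#S(N)`", p. 1190): for
every `N > 1` prime to `6`, `6·#{χ mod N odd : B_{1,χ} = 0} < #{χ mod N odd}`. [cite: KoblitzRohrlich1978, §2 Proposition (pp. 1190–1192)] -/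
theorem six_mul_card_bad_lt_card_odd_of_five_le_primeFactors (hN1 : 1 < N) (h5 : ∀ ℓ ∈ N.primeFactors, 5 ≤ ℓ) :
    6 * Nat.card {χ : DirichletCharacter ℂ N // χ.Odd ∧ bernoulliOneChar χ = 0} <
      Nat.card {χ : DirichletCharacter ℂ N // χ.Odd} := by
  have hN0 : N ≠ 0 := by omega
  have hN5 : 5 ≤ N :=
    (h5 N.minFac (Nat.mem_primeFactors.2 ⟨Nat.minFac_prime hN1.ne', Nat.minFac_dvd N, hN0⟩)).trans (Nat.minFac_le (by omega))
  have h := twelve_mul_card_bad_lt_totient_of_five_le_primeFactors hN1 h5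
  have h2 := two_mul_card_odd_eq_totient (N := N) (by omega)
  omega

end Printed

end CyclotomicFermatCMType

end Literature.AlgebraicGeometry.ComplexMultiplication
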